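import Mathlib
import Literature.NumberTheory.LFunctions.Zhang2022.SkeletonSetting
import Literature.NumberTheory.LFunctions.SiegelTheorem
import Literature.NumberTheory.LFunctions.LandauPageRealZeros
import Literature.NumberTheory.LFunctions.HeckeLOneBound
import HarnessLib

/-!
# Zhang (2022), §1 and §2 up to (2.5) — every displayed claim, typed (campaign row L1-t1)

Topic `Literature/NumberTheory/LFunctions/Zhang2022` (Landau–Siegel audit tree; verdict-neutral).
Y. Zhang, *Discrete mean estimates and the Landau–Siegel zero*, arXiv:2211.02515v1 (2022)
[Zhang2022LandauSiegel] — **an unrefereed manuscript under adjudication. Nothing in this file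
asserts or denies its Theorems 1–2.** Row `L1-t1` of the cell's plan/L1/ASSIGNMENTS.md: the
Introduction (§1, PDF pp. 2–3, TeX L169–245; expository) and §2 "Notation and outline of the proof"
up to (2.5) (PDF pp. 3–5, TeX L248–334): DAG nodes `Z22:§1.u001 … Z22:(2.5)`. Every `def … : Prop`
is a displayed CLAIM, STATED (with the locator read on the page), NOT ASSERTED; where the tree
already PROVES it (`Section2GammaFactor` / `Section2FunctionalEquation`, namespace
`…Zhang2022.GammaFactor`; `SiegelTheorem`), a one-line `…_holds` theorem discharges the node by
citing that declaration. Nodes that are banked skeleton declarations are CITED, not restated.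

| DAG node | Lean name | status here |
|---|---|---|
| `§1.u001` "at most one real simple zero `ρ̃` with `1 − ρ̃ < c₀(log D)⁻¹`" | `Section1.Step1u001` | DISCHARGED `step1u001_holds` (wave 2; tree `DirichletZFR.exists_inv_LFunction_bounds`); of record for §1: `Section1.landauPage` (row L1-t4) |
| `§1.u002` Siegel's theorem `L(1,χ) > C₁(ε)D^{−ε}` | `Section1.step1u002` | DISCHARGED from tree `siegel_lower_bound_holds` (no new def) |
| `§1.u003` `L(σ,χ) ≠ 0` for `σ > 1 − C₂(ε)D^{−ε}` | `Section1.Step1u003` | DISCHARGED `step1u003_holds` (wave 2); of record: `Section1.siegel_zeroFree` (row L1-t4) |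
| `(1.1)` `L(1,χ) ≫ (log D)⁻¹` = `Skeleton.LOneLowerBound 1` (cited instantiation, a CONDITIONAL display); "no Landau–Siegel zero implies (1.1)" [9] | `Section1.Eq11Imp` | DISCHARGED `eq11Imp_holds` (wave 2, via `hecke_lOne_lower_bounds`: MV Thm. 11.4 both halves with ONE constant); corollary `theorem1_of_noSiegelZeros : NoSiegelZeros → Skeleton.Theorem1`; of record: `Section1.eq11` (row L1-t4) |
| `§1.u004` Goldfeld–Gross–Zagier `L(1,χ) ≫ D^{−1/2}(log D)^{1−ε}` (`χ(−1) = −1`) | — | noted (expository: a deep published theorem [10], [12] quoted for context, used nowhere in the argument; deliberately NOT typed as a named fact) |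
| `Thm1`, `§1.u005` | `Skeleton.Theorem1` (`= LOneLowerBound 2022`) | cited (landed) |
| `Thm2`, `§1.u006`, `§1.u007` | `Skeleton.Theorem2` (`= ZeroFreeRegion 2024`); `Skeleton.theorem2_of_theorem1` | cited (landed) |
| `§2.u001`, `§2.u002`, `§2.u004` (`Σ_n`, `Σ_{(n,k)=1}`, `Σ_θ`, `Σ′_θ`, `Σ*_θ`) | — notation only | noted |
| `(2.1)` `𝓛 = log D` | `Skeleton.ell` | cited (object) |
| `§2.u003` Gauss sum `τ(θ) = Σ_{a mod k} θ(a)e(a/k)` | `Step2u003` (object: `GammaFactor.tau` = Mathlib `gaussSum θ stdAddChar`) | discharged |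
| `(2.2)` functional equation | `Eq22` | discharged (`GammaFactor.LFunction_eq_Zfac_mul`) |
| `§2.u005`, `§2.u006` `Z(s,θ)` even / odd | `Step2u005`, `Step2u006` (object: `GammaFactor.Zfac`) | discharged (unfolding) |
| `(2.3)` `ϑ(s)` | `Eq23` (object: `GammaFactor.vartheta`) | discharged (unfolding) |
| `§2.u007`, `§2.u008` the two "It is known that" | `Step2u007`, `Step2u008` | discharged (`gammaQuotient_even_eq`, `gammaQuotient_odd_eq_cot`) |
| `§2.u009` `i cot(πs/2) = 1 + O(e^{−πt})` | `Step2u009` | discharged (`norm_I_mul_cot_sub_one_le'`, `C = 3`) |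
| `(2.4)`, `(2.5)` | `Eq24`, `Eq25` | discharged (`Zfac_eq`, `norm_corr_le`; `Zfac_inv_eq`, `C = 6`) |

Conventions (the cell's skel/INTERFACE.md §3, ASSIGNMENTS §3): namespaces `…Zhang2022.Section1` /
`…Zhang2022.Section2`, names from node ids (`Eq<n><m>`, `Step<n>u<NNN>`), norms for `|·|`.
Pointwise identities between meromorphic functions ((2.2), the "It is known that" pair) carry the
honest pole exclusions of the tree modules they cite; (2.2) is typed off the real axis — the only
range in which the manuscript uses it ("`M(s,ψ)` is defined for `t > 0` only", p. 7) — and for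
moduli `k ≠ 1` (the manuscript's moduli are `p` and `Dp`). Print slip recorded: §1 cites Siegel's
theorem as "[19]" (= Titchmarsh in the bibliography); Siegel 1936 is [18].

## References

* Y. Zhang, arXiv:2211.02515v1 (2022), §1 pp. 2–3, §2 pp. 3–5. [cite: Zhang2022LandauSiegel, §§1–2]
* E. C. Titchmarsh, *The Theory of the Riemann Zeta-Function*, 2nd ed. (1986), §2.1
  (2.1.10)–(2.1.11) (the gamma-quotient identities, via the tree's `Section2GammaFactor`).
  [cite: Titchmarsh1986, §2.1]
* C. L. Siegel, Acta Arith. 1 (1936) (Zhang's [18]); tree `siegel_lower_bound_holds`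
  (Montgomery–Vaughan Thm. 11.14). [cite: Siegel1935, main theorem]
* H. L. Montgomery, R. C. Vaughan, *Multiplicative Number Theory I* (2007), Thm. 11.3 (at most one
  real zero near `1`; tree `DirichletZFR.exists_min_realZeros_le`). [cite: MontgomeryVaughan2007, Thm. 11.3]
-/

noncomputable section

open Complex Real

/-! ## §1 Introduction (pp. 2–3): the expository displays -/

namespace Literature.NumberTheory.LFunctions.Zhang2022.Section1

open Literature.NumberTheory.LFunctions.Zhang2022

/-- `Z22:§1.u001` [Z22 p.2, tex L176] "It is known that the Dirichlet `L`-function `L(s,χ)` has at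
most one real and simple zero `ρ̃` satisfying `1 − ρ̃ < c₀(log D)⁻¹` where `c₀ > 0` is an absolute
constant. Such a zero is called the Landau–Siegel zero." (`χ` real primitive mod `D`.) Typed: there
is an absolute `c₀ > 0` such that any two real zeros of `L(s,χ)` in `1 − σ < c₀/log D` coincide,
and such a zero is simple. EXPOSITORY (classical; the "at most one" part is the tree's
`DirichletZFR.exists_min_realZeros_le`, MV Thm. 11.3). [cite: Zhang2022LandauSiegel, §1 p.2]
[cite: MontgomeryVaughan2007, Thm. 11.3] -/
def Step1u001 : Prop :=
  ∃ c₀ : ℝ, 0 < c₀ ∧ ∀ (D : ℕ) [NeZero D] (χ : DirichletCharacter ℂ D),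
    3 ≤ D → χ.IsQuadratic → χ.IsPrimitive →
      (∀ σ σ' : ℝ, 1 - σ < c₀ / Real.log D → 1 - σ' < c₀ / Real.log D →
        χ.LFunction σ = 0 → χ.LFunction σ' = 0 → σ = σ') ∧
      (∀ σ : ℝ, 1 - σ < c₀ / Real.log D → χ.LFunction σ = 0 → deriv χ.LFunction σ ≠ 0)

/-- The "at most one" half of `Z22:§1.u001`, PROVED: two real zeros of `L(s,χ)` (`χ` real primitive
mod `D ≥ 3`) with `1 − σ < c₀/log D` coincide, `c₀ = c/3` for the constant `c` of the tree's
`DirichletZFR.exists_min_realZeros_le` (MV Thm. 11.3 Case 4: `min(β₀,β₁) ≤ 1 − c/(log q + log 4)`;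
`log 4 ≤ 2 log D`). [cite: Zhang2022LandauSiegel, §1 p.2] [cite: MontgomeryVaughan2007, Thm. 11.3] -/
theorem step1u001_atMostOne : ∃ c₀ : ℝ, 0 < c₀ ∧ ∀ (D : ℕ) [NeZero D] (χ : DirichletCharacter ℂ D),
    3 ≤ D → χ.IsQuadratic → χ.IsPrimitive →
      ∀ σ σ' : ℝ, 1 - σ < c₀ / Real.log D → 1 - σ' < c₀ / Real.log D →
        χ.LFunction σ = 0 → χ.LFunction σ' = 0 → σ = σ' := by
  obtain ⟨c, hc, h⟩ := DirichletZFR.exists_min_realZeros_le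
  refine ⟨c / 3, by positivity, fun D _ χ hD _ hp σ σ' hσ hσ' h0 h0' => ?_⟩
  by_contra hne
  have hχ : χ ≠ 1 := Skeleton.ne_one_of_isPrimitive_of_three_le hp hD
  have hmin := h D χ hχ σ σ' h0 h0' hne
  have hD' : (3 : ℝ) ≤ D := by exact_mod_cast hD
  have hlogD : 0 < Real.log D := Real.log_pos (by linarith)
  have hlog4 : Real.log 4 ≤ 2 * Real.log D :=
    calc Real.log 4 ≤ Real.log ((D : ℝ) ^ 2) := Real.log_le_log (by norm_num) (by nlinarith)
      _ = 2 * Real.log D := by rw [Real.log_pow]; norm_num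
  have key : c / 3 / Real.log D ≤ c / (Real.log D + Real.log 4) := by
    rw [div_div, div_le_div_iff_of_pos_left hc (by positivity) (by positivity)]
    linarith
  have h1 : 1 - c / (Real.log D + Real.log 4) < min σ σ' := lt_min (by linarith) (by linarith)
  linarith

/-- `Z22:§1.u002` [Z22 p.2, tex L186] "The well-known Siegel theorem [19] asserts that, for any
`ε > 0`, there exists a positive number `C₁(ε)` such that `L(1,χ) > C₁(ε)D^{−ε}`" (print: "[19]" is
Titchmarsh in the bibliography; Siegel 1936 is [18]). NOT a new definition: this is the tree's
named fact `Literature.NumberTheory.LFunctions.siegel_lower_bound`, PROVED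
(`siegel_lower_bound_holds`); here its printed shape (strict `>`, `|L(1,χ)|`, moduli `D ≥ 3`) as a
theorem. EXPOSITORY. [cite: Zhang2022LandauSiegel, §1 p.2] [cite: Siegel1935, main theorem] -/
theorem step1u002 : ∀ ε : ℝ, 0 < ε → ∃ C₁ : ℝ, 0 < C₁ ∧
    ∀ (D : ℕ) [NeZero D] (χ : DirichletCharacter ℂ D), 3 ≤ D → χ.IsQuadratic → χ.IsPrimitive →
      C₁ * (D : ℝ) ^ (-ε) < ‖χ.LFunction 1‖ := by
  intro ε hε
  obtain ⟨C, hC, h⟩ := Literature.NumberTheory.LFunctions.siegel_lower_bound_holds ε hε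
  refine ⟨C / 2, by positivity, fun D _ χ hD hq hp => ?_⟩
  have hre := h D hD χ hq hp
  have hpow : 0 < (D : ℝ) ^ (-ε) := Real.rpow_pos_of_pos (by exact_mod_cast (by omega : 0 < D)) _
  calc C / 2 * (D : ℝ) ^ (-ε) < C * (D : ℝ) ^ (-ε) := by nlinarith
    _ ≤ (χ.LFunction 1).re := hre
    _ ≤ ‖χ.LFunction 1‖ := Complex.re_le_norm _

/-- `Z22:§1.u003` [Z22 p.2, tex L191] "This implies, for any `ε > 0`, that there exists a positive
number `C₂(ε)` such that `L(σ,χ) ≠ 0` if `σ > 1 − C₂(ε)D^{−ε}`." EXPOSITORY (classical consequence of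
Siegel's theorem via `L(1,χ) ≪ (1 − β₁)log²D`, MV (11.10)); stated, not proved here.
[cite: Zhang2022LandauSiegel, §1 p.2] -/
def Step1u003 : Prop :=
  ∀ ε : ℝ, 0 < ε → ∃ C₂ : ℝ, 0 < C₂ ∧
    ∀ (D : ℕ) [NeZero D] (χ : DirichletCharacter ℂ D), 3 ≤ D → χ.IsQuadratic → χ.IsPrimitive →
      ∀ σ : ℝ, 1 - C₂ * (D : ℝ) ^ (-ε) < σ → χ.LFunction σ ≠ 0

/-- `Z22:(1.1)` [Z22 p.2, (1.1), tex L202–203] "It is known (see [9]) that the non-existence of the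
Landau–Siegel zero implies `L(1,χ) ≫ (log D)⁻¹` (1.1)." The display (1.1) by itself is the
skeleton's `LOneLowerBound 1` (Theorem 1 is `LOneLowerBound 2022`) — a CONDITIONAL assertion in the
manuscript, so only the implication is typed, with the tree's `NoSiegelZeros` (rh.S34: `L(σ,χ) ≠ 0`
for `σ > 1 − c/log q`, all real primitive `χ`) as antecedent. EXPOSITORY (classical: Hecke/Landau,
MV Thm. 11.4; the per-character halves are the tree's `MontgomeryVaughan2007_thm11_4_LOne_holds` /
`…_exceptional_holds`); stated, not proved here. [cite: Zhang2022LandauSiegel, §1 (1.1) p.2] -/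
def Eq11Imp : Prop := Literature.NumberTheory.LFunctions.NoSiegelZeros → Skeleton.LOneLowerBound 1

/- `Z22:§1.u004` [Z22 p.3, tex L206] (Goldfeld [10], Gross–Zagier [12]: `L(1,χ) ≫ D^{−1/2}(log D)^{1−ε}`
for `χ(−1) = −1`) and the Granville–Stark sentence [11] are expository context, used nowhere in the
argument: NOTED, deliberately not typed as named facts. -/

/-- `Z22:Thm1`/`§1.u005` and `Z22:Thm2`/`§1.u006`–`u007` [Z22 p.3, tex L218–236] are the skeleton's
`Theorem1 = LOneLowerBound 2022` and `Theorem2 = ZeroFreeRegion 2024` (CITED, not restated), and "As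
a direct consequence of Theorem 1 we have Theorem 2" is the skeleton's kernel-checked
`theorem2_of_theorem1`; re-exported here under the section's name for the DAG.
[cite: Zhang2022LandauSiegel, §1 p.3] -/
theorem thm2_of_thm1 (h : Skeleton.Theorem1) : Skeleton.Theorem2 := Skeleton.theorem2_of_theorem1 h

end Literature.NumberTheory.LFunctions.Zhang2022.Section1

/-! ## §2 up to (2.5) (pp. 3–5): the Gauss sum, (2.2), `Z(s,θ)`, `ϑ(s)` (2.3), (2.4)–(2.5) -/

namespace Literature.NumberTheory.LFunctions.Zhang2022.Section2

open Literature.NumberTheory.LFunctions.Zhang2022 GammaFactor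

/-- `Z22:§2.u003` [Z22 p.4, tex L286] "For any Dirichlet character `θ` to the modulus `k`, let `τ(θ)`
denote the Gauss sum `τ(θ) = Σ_{a (mod k)} θ(a)e(a/k)`", `e(s) = exp{2πis}` (p. 4). The OBJECT is the
tree's `GammaFactor.tau θ := gaussSum θ stdAddChar` (Mathlib); the node is the claim that it IS the
printed sum. (`§2.u001`, `u002`, `u004` are summation notation, no claim.)
[cite: Zhang2022LandauSiegel, §2 p.4 (definition of τ(θ))] -/
def Step2u003 : Prop :=
  ∀ (k : ℕ) [NeZero k] (θ : DirichletCharacter ℂ k),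
    tau θ = ∑ a : ZMod k, θ a * cexp (2 * π * I * (a.val : ℂ) / (k : ℂ))

/-- `Step2u003` holds (unfolding Mathlib's `gaussSum` and `stdAddChar`).
[cite: Zhang2022LandauSiegel, §2 p.4] -/
theorem step2u003_holds : Step2u003 := by
  intro k _ θ
  simp only [gaussSum, ZMod.stdAddChar_apply, ZMod.toCircle_apply]

/-- `Step2u003` — `_holds` alias of `step2u003_holds` above under the fact's exact name (appended
2026-08-28, D-0026 bookkeeping: the proof term is the existing theorem of this file; no statement,
definition or attribute is edited; no new named fact; the ledger's debt table listed the fact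
unproved). [cite: Zhang2022LandauSiegel, §2 p.4] -/
theorem _root_.Literature.NumberTheory.LFunctions.Zhang2022.Section2.Step2u003_holds : Step2u003 :=
  _root_.Literature.NumberTheory.LFunctions.Zhang2022.Section2.step2u003_holds

/-- `Z22:(2.2)` [Z22 p.4, (2.2), tex L298] "In case `θ (mod k)` is a primitive character, the
functional equation for `L(s,θ)` is `L(s,θ) = Z(s,θ)L(1−s,θ̄)`", `Z(s,θ) = GammaFactor.Zfac θ s` (the
printed even/odd `Γ`-quotients, `Step2u005`/`Step2u006`), `θ̄ = θ⁻¹`. Typed for moduli `k ≠ 1` and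
off the real axis (`t ≠ 0`), where both sides are pole-free — the printed identity is one of
meromorphic functions; the manuscript uses it for `t > 0` only (p. 7).
[cite: Zhang2022LandauSiegel, §2 (2.2) p.4] -/
def Eq22 : Prop :=
  ∀ (k : ℕ) [NeZero k] (θ : DirichletCharacter ℂ k), θ.IsPrimitive → k ≠ 1 →
    ∀ s : ℂ, s.im ≠ 0 → θ.LFunction s = Zfac θ s * θ⁻¹.LFunction (1 - s)

/-- `Eq22` holds: the tree's `GammaFactor.LFunction_eq_Zfac_mul` (from Mathlib's
`completedLFunction_one_sub`). [cite: Zhang2022LandauSiegel, §2 (2.2) p.4] -/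
theorem eq22_holds : Eq22 := fun _ _ _ hθ hk _ hs => LFunction_eq_Zfac_mul hθ hk hs

/-- `Z22:§2.u005` [Z22 p.4, tex L302] "`Z(s,θ) = τ(θ)π^{s−1/2}k^{−s}Γ((1−s)/2)Γ(s/2)⁻¹` if
`θ(−1) = 1`" (OBJECT: `GammaFactor.Zfac`). [cite: Zhang2022LandauSiegel, §2 p.4 (after (2.2))] -/
def Step2u005 : Prop :=
  ∀ (k : ℕ) [NeZero k] (θ : DirichletCharacter ℂ k), θ.Even → ∀ s : ℂ,
    Zfac θ s = tau θ * (π : ℂ) ^ (s - 1 / 2) * (k : ℂ) ^ (-s)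
      * Complex.Gamma ((1 - s) / 2) * (Complex.Gamma (s / 2))⁻¹

/-- `Step2u005` holds by unfolding `GammaFactor.Zfac`. [cite: Zhang2022LandauSiegel, §2 p.4] -/
theorem step2u005_holds : Step2u005 := by
  intro k _ θ hθ s
  classical
  rw [Zfac, if_pos hθ]

/-- `Step2u005` — `_holds` alias of `step2u005_holds` above under the fact's exact name (appended
2026-08-28, D-0026 bookkeeping: the proof term is the existing theorem of this file; no statement,
definition or attribute is edited; no new named fact; the ledger's debt table listed the fact
unproved). [cite: Zhang2022LandauSiegel, §2 p.4] -/
theorem _root_.Literature.NumberTheory.LFunctions.Zhang2022.Section2.Step2u005_holds : Step2u005 :=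
  _root_.Literature.NumberTheory.LFunctions.Zhang2022.Section2.step2u005_holds

/-- `Z22:§2.u006` [Z22 pp.4–5, tex L306] "`Z(s,θ) = −iτ(θ)π^{s−1/2}k^{−s}Γ((2−s)/2)Γ((1+s)/2)⁻¹` if
`θ(−1) = −1`" (OBJECT: `GammaFactor.Zfac`). [cite: Zhang2022LandauSiegel, §2 pp.4–5 (after (2.2))] -/
def Step2u006 : Prop :=
  ∀ (k : ℕ) [NeZero k] (θ : DirichletCharacter ℂ k), θ.Odd → ∀ s : ℂ,
    Zfac θ s = -I * tau θ * (π : ℂ) ^ (s - 1 / 2) * (k : ℂ) ^ (-s)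
      * Complex.Gamma ((2 - s) / 2) * (Complex.Gamma ((1 + s) / 2))⁻¹

/-- `Step2u006` holds by unfolding `GammaFactor.Zfac` (an odd character is not even:
`θ(−1) = −1 ≠ 1`). [cite: Zhang2022LandauSiegel, §2 pp.4–5] -/
theorem step2u006_holds : Step2u006 := by
  intro k _ θ hθ s
  classical
  have hne : ¬ θ.Even := by
    intro he
    have h : (1 : ℂ) = -1 := he.symm.trans hθ
    norm_num at h
  rw [Zfac, if_neg hne]

/-- `Step2u006` — `_holds` alias of `step2u006_holds` above under the fact's exact name (appended
2026-08-28, D-0026 bookkeeping: the proof term is the existing theorem of this file; no statement,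
definition or attribute is edited; no new named fact; the ledger's debt table listed the fact
unproved). [cite: Zhang2022LandauSiegel, §2 pp.4–5] -/
theorem _root_.Literature.NumberTheory.LFunctions.Zhang2022.Section2.Step2u006_holds : Step2u006 :=
  _root_.Literature.NumberTheory.LFunctions.Zhang2022.Section2.step2u006_holds

/-- `Z22:(2.3)` [Z22 p.5, (2.3), tex L311] "`ϑ(s) = 2(2π)^{s−1}Γ(1−s) sin(πs/2)` (this function is
usually written as `χ(s)` in the literature)" (OBJECT: `GammaFactor.vartheta`).
[cite: Zhang2022LandauSiegel, §2 (2.3) p.5] -/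
def Eq23 : Prop :=
  ∀ s : ℂ, vartheta s = 2 * (2 * π : ℂ) ^ (s - 1) * Complex.Gamma (1 - s) * Complex.sin (π * s / 2)

/-- `Eq23` holds by definition of `GammaFactor.vartheta`. [cite: Zhang2022LandauSiegel, §2 (2.3) p.5] -/
theorem eq23_holds : Eq23 := fun _ => rfl

/-- `Eq23` — `_holds` alias of `eq23_holds` above under the fact's exact name (appended
2026-08-28, D-0026 bookkeeping: the proof term is the existing theorem of this file; no statement,
definition or attribute is edited; no new named fact; the ledger's debt table listed the fact
unproved). [cite: Zhang2022LandauSiegel, §2 (2.3) p.5] -/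
theorem _root_.Literature.NumberTheory.LFunctions.Zhang2022.Section2.Eq23_holds : Eq23 :=
  _root_.Literature.NumberTheory.LFunctions.Zhang2022.Section2.eq23_holds

/-- `Z22:§2.u007` [Z22 p.5, tex L315] first "It is known that": `π^{s−1/2}Γ((1−s)/2)Γ(s/2)⁻¹ = ϑ(s)`
— an identity of meromorphic functions; pointwise off `s = 2, 4, 6, …` (where the right side has a
removable singularity `Γ(1−s)·sin(πs/2)` that Lean's value of `Γ` at its poles does not see).
[cite: Zhang2022LandauSiegel, §2 p.5 (after (2.3))] -/
def Step2u007 : Prop :=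
  ∀ s : ℂ, (∀ n : ℕ, s ≠ 2 * n + 2) →
    (π : ℂ) ^ (s - 1 / 2) * Complex.Gamma ((1 - s) / 2) * (Complex.Gamma (s / 2))⁻¹ = vartheta s

/-- `Step2u007` holds: the tree's `GammaFactor.gammaQuotient_even_eq` (Titchmarsh (2.1.10)).
[cite: Zhang2022LandauSiegel, §2 p.5] [cite: Titchmarsh1986, §2.1 (2.1.10)] -/
theorem step2u007_holds : Step2u007 := fun _ hs => gammaQuotient_even_eq hs

/-- `Step2u007` — `_holds` alias of `step2u007_holds` above under the fact's exact name (appended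
2026-08-28, D-0026 bookkeeping: the proof term is the existing theorem of this file; no statement,
definition or attribute is edited; no new named fact; the ledger's debt table listed the fact
unproved). [cite: Titchmarsh1986, §2.1 (2.1.10)] -/
theorem _root_.Literature.NumberTheory.LFunctions.Zhang2022.Section2.Step2u007_holds : Step2u007 :=
  _root_.Literature.NumberTheory.LFunctions.Zhang2022.Section2.step2u007_holds

/-- `Z22:§2.u008` [Z22 p.5, tex L319] second "It is known that":
`π^{s−1/2}Γ((2−s)/2)Γ((1+s)/2)⁻¹ = ϑ(s)cot(πs/2)` (`cot = cos/sin`); pointwise off `s = 1, 2, 3, …`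
and where `sin(πs/2) ≠ 0`. [cite: Zhang2022LandauSiegel, §2 p.5 (after (2.3))] -/
def Step2u008 : Prop :=
  ∀ s : ℂ, (∀ n : ℕ, s ≠ n + 1) → Complex.sin (π * s / 2) ≠ 0 →
    (π : ℂ) ^ (s - 1 / 2) * Complex.Gamma ((2 - s) / 2) * (Complex.Gamma ((1 + s) / 2))⁻¹
      = vartheta s * (Complex.cos (π * s / 2) / Complex.sin (π * s / 2))

/-- `Step2u008` holds: the tree's `GammaFactor.gammaQuotient_odd_eq_cot`.
[cite: Zhang2022LandauSiegel, §2 p.5] -/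
theorem step2u008_holds : Step2u008 := fun _ hs hsin => gammaQuotient_odd_eq_cot hs hsin

/-- `Step2u008` — `_holds` alias of `step2u008_holds` above under the fact's exact name (appended
2026-08-28, D-0026 bookkeeping: the proof term is the existing theorem of this file; no statement,
definition or attribute is edited; no new named fact; the ledger's debt table listed the fact
unproved). [cite: Zhang2022LandauSiegel, §2 p.5] -/
theorem _root_.Literature.NumberTheory.LFunctions.Zhang2022.Section2.Step2u008_holds : Step2u008 :=
  _root_.Literature.NumberTheory.LFunctions.Zhang2022.Section2.step2u008_holds

/-- `Z22:§2.u009` [Z22 p.5, tex L323] "Assume `t > 1`. Then `i cot(πs/2) = 1 + O(e^{−πt})`" — with an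
absolute constant: `|i cot(πs/2) − 1| ≤ Ce^{−πt}` for `t = Im s > 1`.
[cite: Zhang2022LandauSiegel, §2 p.5 (before (2.4))] -/
def Step2u009 : Prop :=
  ∃ C : ℝ, ∀ s : ℂ, 1 < s.im →
    ‖I * (Complex.cos (π * s / 2) / Complex.sin (π * s / 2)) - 1‖ ≤ C * Real.exp (-π * s.im)

/-- `Step2u009` holds with `C = 3`: the tree's `GammaFactor.norm_I_mul_cot_sub_one_le'`.
[cite: Zhang2022LandauSiegel, §2 p.5] -/
theorem step2u009_holds : Step2u009 := ⟨3, fun _ hs => norm_I_mul_cot_sub_one_le' hs.le⟩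

/-- `Step2u009` — `_holds` alias of `step2u009_holds` above under the fact's exact name (appended
2026-08-28, D-0026 bookkeeping: the proof term is the existing theorem of this file; no statement,
definition or attribute is edited; no new named fact; the ledger's debt table listed the fact
unproved). [cite: Zhang2022LandauSiegel, §2 p.5] -/
theorem _root_.Literature.NumberTheory.LFunctions.Zhang2022.Section2.Step2u009_holds : Step2u009 :=
  _root_.Literature.NumberTheory.LFunctions.Zhang2022.Section2.step2u009_holds

/-- `Z22:(2.4)` [Z22 p.5, (2.4), tex L327] "Thus we have uniformly
`Z(s,θ) = θ(−1)τ(θ)k^{−s}ϑ(s)(1 + O(e^{−πt}))`" for `t > 1`, "the `O(e^{−πt})` term being identically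
zero in case `θ(−1) = 1`": there is an absolute `C` such that for every `θ (mod k)` and `Im s > 1`,
`Z(s,θ) = θ(−1)τ(θ)k^{−s}ϑ(s)(1 + r)` with `|r| ≤ Ce^{−πt}`, and `r = 0` if `θ` is even.
[cite: Zhang2022LandauSiegel, §2 (2.4) p.5] -/
def Eq24 : Prop :=
  ∃ C : ℝ, ∀ (k : ℕ) [NeZero k] (θ : DirichletCharacter ℂ k) (s : ℂ), 1 < s.im →
    ∃ r : ℂ, ‖r‖ ≤ C * Real.exp (-π * s.im) ∧ (θ.Even → r = 0) ∧
      Zfac θ s = θ (-1) * tau θ * (k : ℂ) ^ (-s) * vartheta s * (1 + r)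

/-- `Eq24` holds with `C = 3`, `r = GammaFactor.corr θ s`: the tree's `Zfac_eq`, `norm_corr_le`,
`corr_eq_zero_of_even`. [cite: Zhang2022LandauSiegel, §2 (2.4) p.5] -/
theorem eq24_holds : Eq24 :=
  ⟨3, fun _ _ θ s hs => ⟨corr θ s, norm_corr_le θ hs.le, fun he => corr_eq_zero_of_even he s,
    Zfac_eq θ (by linarith)⟩⟩

/-- `Z22:(2.5)` [Z22 p.5, (2.5), tex L331] "`Z(s,θ)⁻¹ = τ(θ̄)k^{s−1}ϑ(1−s)(1 + O(e^{−πt}))`" for `t > 1`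
and `θ` primitive (the standing context of (2.2); `θ̄ = θ⁻¹`), the `O`-term identically zero for even
`θ`: with an absolute `C`, `Z(s,θ)⁻¹ = τ(θ̄)k^{s−1}ϑ(1−s)(1 + r)`, `|r| ≤ Ce^{−πt}`.
[cite: Zhang2022LandauSiegel, §2 (2.5) p.5] -/
def Eq25 : Prop :=
  ∃ C : ℝ, ∀ (k : ℕ) [NeZero k] (θ : DirichletCharacter ℂ k), θ.IsPrimitive → ∀ s : ℂ, 1 < s.im →
    ∃ r : ℂ, ‖r‖ ≤ C * Real.exp (-π * s.im) ∧ (θ.Even → r = 0) ∧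
      (Zfac θ s)⁻¹ = tau θ⁻¹ * (k : ℂ) ^ (s - 1) * vartheta (1 - s) * (1 + r)

/-- `Eq25` holds with `C = 6`, `r = (1 + corr θ s)⁻¹ − 1`: the tree's `Zfac_inv_eq` and
`norm_inv_one_add_corr_sub_one_le`. [cite: Zhang2022LandauSiegel, §2 (2.5) p.5] -/
theorem eq25_holds : Eq25 := by
  refine ⟨6, fun k _ θ hθ s hs => ⟨(1 + corr θ s)⁻¹ - 1, norm_inv_one_add_corr_sub_one_le θ hs.le,
    fun he => ?_, ?_⟩⟩
  · rw [corr_eq_zero_of_even he s]; simp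
  · rw [add_sub_cancel, Zfac_inv_eq hθ (by linarith)]

end Literature.NumberTheory.LFunctions.Zhang2022.Section2

/-! ## Wave 2 (row L1-t1): the §1 expository claims DISCHARGED, and "rh.S34 ⇒ Theorems 1–2" -/

namespace Literature.NumberTheory.LFunctions.Zhang2022.Section1

open Literature.NumberTheory.LFunctions.Zhang2022
open Literature.NumberTheory.LFunctions

/-- `log D ≥ 1` for `D ≥ 3`. [folklore] -/
private theorem one_le_log_of_three_le {D : ℕ} (hD : 3 ≤ D) : 1 ≤ Real.log D := by
  have hD' : (3 : ℝ) ≤ D := by exact_mod_cast hD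
  rw [Real.le_log_iff_exp_le (by linarith)]
  have := Real.exp_one_lt_d9
  linarith

/-- `Z22:§1.u001` DISCHARGED: "at most one real and simple zero `ρ̃` with `1 − ρ̃ < c₀(log D)⁻¹`",
with `c₀ = 2c/3` for the constant `c` of the tree's `DirichletZFR.exists_inv_LFunction_bounds`
(MV Thm. 11.3: uniqueness and simplicity of a real zero in `σ > 1 − 2c/(log q + log 4)`;
`log 4 ≤ 2 log D` for `D ≥ 3`). [cite: Zhang2022LandauSiegel, §1 p.2]
[cite: MontgomeryVaughan2007, Thm. 11.3] -/
theorem step1u001_holds : Step1u001 := by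
  obtain ⟨c, hc, -, C, -, -, huniq, -, hsimple⟩ := DirichletZFR.exists_inv_LFunction_bounds
  refine ⟨2 * c / 3, by positivity, fun D _ χ hD _ hp => ?_⟩
  have hχ : χ ≠ 1 := Skeleton.ne_one_of_isPrimitive_of_three_le hp hD
  have hD' : (3 : ℝ) ≤ D := by exact_mod_cast hD
  have hlogD : 0 < Real.log D := Real.log_pos (by linarith)
  have hlog4 : Real.log 4 ≤ 2 * Real.log D :=
    calc Real.log 4 ≤ Real.log ((D : ℝ) ^ 2) := Real.log_le_log (by norm_num) (by nlinarith)
      _ = 2 * Real.log D := by rw [Real.log_pow]; norm_num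
  have hlog4pos : 0 < Real.log 4 := Real.log_pos (by norm_num)
  have region : ∀ σ : ℝ, 1 - σ < 2 * c / 3 / Real.log D →
      1 - 2 * c / (Real.log D + Real.log 4) < σ := by
    intro σ hσ
    have key : 2 * c / 3 / Real.log D ≤ 2 * c / (Real.log D + Real.log 4) := by
      rw [div_div, div_le_div_iff_of_pos_left (by positivity) (by positivity) (by positivity)]
      linarith
    linarith
  exact ⟨fun σ σ' hσ hσ' h0 h0' => huniq D χ hχ σ σ' h0 h0' (region σ hσ) (region σ' hσ'),
    fun σ hσ h0 => (hsimple D χ hχ σ h0 (region σ hσ)).1⟩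

/-- `Step1u001` — `_holds` alias of `step1u001_holds` above under the fact's exact name (appended
2026-08-28, D-0026 bookkeeping: the proof term is the existing theorem of this file; no statement,
definition or attribute is edited; no new named fact; the ledger's debt table listed the fact
unproved). [cite: MontgomeryVaughan2007, Thm. 11.3] -/
theorem _root_.Literature.NumberTheory.LFunctions.Zhang2022.Section1.Step1u001_holds : Step1u001 :=
  _root_.Literature.NumberTheory.LFunctions.Zhang2022.Section1.step1u001_holds

/-- **Hecke's theorem in both directions with ONE zero-free constant** (Montgomery–Vaughan Thm.
11.4, (11.7) and the lower half of (11.10), at `s = 1`): there are absolute `c, C₀, C₁ > 0` such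
that for every non-principal `χ` mod `q`, with `ℒ₀ = log q + log 4`: (a) if every real zero of
`L(s,χ)` is `≤ 1 − 2c/ℒ₀` then `‖L(1,χ)‖ ≥ C₀/ℒ₀`; (b) if `β` is a real zero with `β > 1 − 2c/ℒ₀` then
`‖L(1,χ)‖ ≥ C₁(1 − β)`. Both halves come from the SAME instance of the tree's package
`DirichletZFR.exists_norm_logDeriv_sub_polar_le` (the tree's `MontgomeryVaughan2007_thm11_4_LOne_holds`
and `…_exceptional_holds` prove (a) and (b) with independent existential constants, which leaves a
band of zeros uncovered when the two are combined); the Grönwall steps are those of the tree's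
`HeckeLOneBound`. [cite: MontgomeryVaughan2007, Thm. 11.4 (11.7), (11.10)] -/
theorem hecke_lOne_lower_bounds :
    ∃ c : ℝ, 0 < c ∧ ∃ C₀ : ℝ, 0 < C₀ ∧ ∃ C₁ : ℝ, 0 < C₁ ∧
      ∀ (q : ℕ) [NeZero q] (χ : DirichletCharacter ℂ q), χ ≠ 1 →
        ((∀ β : ℝ, χ.LFunction β = 0 → β ≤ 1 - 2 * c / (Real.log q + Real.log 4)) →
            C₀ / (Real.log q + Real.log 4) ≤ ‖χ.LFunction 1‖) ∧
        (∀ β : ℝ, χ.LFunction β = 0 → 1 - 2 * c / (Real.log q + Real.log 4) < β →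
            C₁ * (1 - β) ≤ ‖χ.LFunction 1‖) := by
  obtain ⟨c, hc, -, C, hC0, -, -, -, hA, hB⟩ := DirichletZFR.exists_norm_logDeriv_sub_polar_le
  refine ⟨c, hc, Real.exp (-(C / 8)) / 9, by positivity,
    Real.exp (-(C / 8)) / (9 * (1 / 8 + 2 * c)), by positivity, fun q _ χ hχ => ?_⟩
  -- common set-up (as in the tree's `HeckeLOneBound`)
  set ℒ₀ : ℝ := Real.log q + Real.log 4 with hℒ₀def
  have hℒ₀1 : 1 ≤ ℒ₀ := PagePNT.one_le_ell0 q
  have hℒ₀0 : 0 < ℒ₀ := by linarith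
  have hℒ₀nn : 0 ≤ ℒ₀ := hℒ₀0.le
  set σ₁ : ℝ := 1 + 1 / (8 * ℒ₀) with hσ₁def
  have hκ : 0 < 1 / (8 * ℒ₀) := by positivity
  have hκ1 : 1 / (8 * ℒ₀) ≤ 1 / 8 := by
    rw [div_le_div_iff₀ (by positivity) (by norm_num)]; linarith
  have h1σ₁ : (1 : ℝ) < σ₁ := by rw [hσ₁def]; linarith
  have hexp : C * ℒ₀ * (σ₁ - 1) = C / 8 := by rw [hσ₁def]; field_simp; ring
  have hreg : ∀ u : ℝ, 1 ≤ u →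
      1 - c / (Real.log q + Real.log (|(u : ℂ).im| + 4)) ≤ (u : ℂ).re := by
    intro u hu
    simp only [Complex.ofReal_im, abs_zero, zero_add, Complex.ofReal_re]
    have : 0 ≤ c / ℒ₀ := div_nonneg hc.le hℒ₀nn
    linarith
  -- `1/(9ℒ₀) ≤ ‖L(σ₁, χ)‖`
  obtain ⟨hL₁0, hright⟩ :=
    DirichletZFR.norm_inv_LFunction_le_right χ (s := (σ₁ : ℂ)) hℒ₀1 (by simp [hσ₁def])
  have hL₁pos : 0 < ‖χ.LFunction σ₁‖ := norm_pos_iff.2 hL₁0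
  have hL₁low : 1 / (9 * ℒ₀) ≤ ‖χ.LFunction σ₁‖ := by
    rw [norm_inv] at hright
    rw [one_div]
    exact inv_le_of_inv_le₀ hL₁pos hright
  constructor
  · -- (a) no exceptional zero: Grönwall for `L` itself on `[1, σ₁]` with `‖L'/L‖ ≤ Cℒ₀`
    intro hnone
    have hLd : Differentiable ℂ χ.LFunction := DirichletCharacter.differentiable_LFunction hχ
    have hld : ∀ u : ℝ, 1 ≤ u → ‖deriv χ.LFunction u‖ ≤ C * ℒ₀ * ‖χ.LFunction u‖ := by
      intro u hu
      obtain ⟨hL0, hb⟩ := hA q χ hχ hnone (u : ℂ) (hreg u hu)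
      have hb' : ‖deriv χ.LFunction u / χ.LFunction u‖ ≤ C * ℒ₀ := by
        simpa only [Complex.ofReal_im, abs_zero, zero_add] using hb
      calc ‖deriv χ.LFunction u‖
          = ‖deriv χ.LFunction u / χ.LFunction u‖ * ‖χ.LFunction u‖ := by
            rw [← norm_mul, div_mul_cancel₀ _ hL0]
        _ ≤ C * ℒ₀ * ‖χ.LFunction u‖ := mul_le_mul_of_nonneg_right hb' (norm_nonneg _)
    have hfwd : ‖χ.LFunction σ₁‖ ≤ ‖χ.LFunction 1‖ * Real.exp (C / 8) := by
      have h := DirichletZFR.norm_le_norm_mul_exp_of_deriv_le hLd (σ := 1) (σ₁ := σ₁) (t := 0)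
        (K := C * ℒ₀) h1σ₁.le (fun u hu ↦ by simpa using hld u hu.1)
      simpa only [Complex.ofReal_zero, zero_mul, add_zero, Complex.ofReal_one, hexp] using h
    have h1 : ‖χ.LFunction σ₁‖ * Real.exp (-(C / 8)) ≤ ‖χ.LFunction 1‖ := by
      rw [Real.exp_neg, ← div_eq_mul_inv, div_le_iff₀ (Real.exp_pos _)]; exact hfwd
    calc Real.exp (-(C / 8)) / 9 / ℒ₀ = 1 / (9 * ℒ₀) * Real.exp (-(C / 8)) := by
          field_simp
      _ ≤ ‖χ.LFunction σ₁‖ * Real.exp (-(C / 8)) := by gcongr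
      _ ≤ ‖χ.LFunction 1‖ := h1
  · -- (b) an exceptional zero `β₁`: Grönwall for `g = L(s,χ)/(s − β₁)` with `‖g'/g‖ ≤ Cℒ₀`
    intro β₁ hLβ₁ hβ₁
    have hβ₁1 : β₁ < 1 := by
      by_contra hge
      push Not at hge
      exact χ.LFunction_ne_zero_of_one_le_re (Or.inl hχ) (by simpa using hge) hLβ₁
    set g : ℂ → ℂ := dslope χ.LFunction (β₁ : ℂ) with hgdef
    have hgd : Differentiable ℂ g := PagePNT.differentiable_dslope_LFunction χ hχ _
    have hgld : ∀ u : ℝ, 1 ≤ u → ‖deriv g u‖ ≤ C * ℒ₀ * ‖g u‖ := by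
      intro u hu
      have huβ : (u : ℂ) ≠ (β₁ : ℂ) := by
        intro h
        have := congrArg Complex.re h
        simp only [Complex.ofReal_re] at this
        linarith
      obtain ⟨hL0, hb⟩ := hB q χ hχ β₁ hLβ₁ hβ₁ (u : ℂ) (hreg u hu) huβ
      have hb' : ‖deriv χ.LFunction u / χ.LFunction u - 1 / ((u : ℂ) - β₁)‖ ≤ C * ℒ₀ := by
        simpa only [Complex.ofReal_im, abs_zero, zero_add] using hb
      have hg0 : g u ≠ 0 := PagePNT.dslope_ne_zero_of_ne χ hLβ₁ hL0
      have heq := PagePNT.logDeriv_LFunction_eq_add χ hχ hLβ₁ hL0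
      have hquot : deriv g u / g u
          = deriv χ.LFunction u / χ.LFunction u - 1 / ((u : ℂ) - β₁) := by
        rw [heq, hgdef]; ring
      calc ‖deriv g u‖ = ‖deriv g u / g u‖ * ‖g u‖ := by
            rw [← norm_mul, div_mul_cancel₀ _ hg0]
        _ ≤ C * ℒ₀ * ‖g u‖ := by
            rw [hquot]; exact mul_le_mul_of_nonneg_right hb' (norm_nonneg _)
    have hfwd : ‖g σ₁‖ ≤ ‖g 1‖ * Real.exp (C / 8) := by
      have h := DirichletZFR.norm_le_norm_mul_exp_of_deriv_le hgd (σ := 1) (σ₁ := σ₁) (t := 0)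
        (K := C * ℒ₀) h1σ₁.le (fun u hu ↦ by simpa using hgld u hu.1)
      simpa only [Complex.ofReal_zero, zero_mul, add_zero, Complex.ofReal_one, hexp] using h
    have hσ₁β : 1 / (8 * ℒ₀) ≤ σ₁ - β₁ := by rw [hσ₁def]; linarith
    have hσ₁β' : σ₁ - β₁ ≤ (1 / 8 + 2 * c) / ℒ₀ := by
      have : (1 / 8 + 2 * c) / ℒ₀ = 1 / (8 * ℒ₀) + 2 * c / ℒ₀ := by field_simp
      rw [this, hσ₁def]; linarith
    have hσ₁βpos : 0 < σ₁ - β₁ := lt_of_lt_of_le hκ hσ₁β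
    have hnormσβ : ‖(σ₁ : ℂ) - β₁‖ = σ₁ - β₁ := by
      rw [← Complex.ofReal_sub, Complex.norm_real, Real.norm_of_nonneg hσ₁βpos.le]
    have hnorm_gσ₁ : ‖g σ₁‖ = ‖χ.LFunction σ₁‖ / (σ₁ - β₁) := by
      have h := PagePNT.LFunction_eq_mul_dslope χ hLβ₁ (σ₁ : ℂ)
      have hne : (σ₁ : ℂ) - β₁ ≠ 0 := by
        rw [← Complex.ofReal_sub]; exact_mod_cast hσ₁βpos.ne'
      have hgσ₁ : g σ₁ = χ.LFunction σ₁ / ((σ₁ : ℂ) - β₁) := by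
        rw [hgdef, h]; field_simp
      rw [hgσ₁, norm_div, hnormσβ]
    have hgσ₁low : 1 / (9 * (1 / 8 + 2 * c)) ≤ ‖g σ₁‖ := by
      rw [hnorm_gσ₁]
      calc 1 / (9 * (1 / 8 + 2 * c)) = (1 / (9 * ℒ₀)) / ((1 / 8 + 2 * c) / ℒ₀) := by
            field_simp
        _ ≤ ‖χ.LFunction σ₁‖ / ((1 / 8 + 2 * c) / ℒ₀) := by gcongr
        _ ≤ ‖χ.LFunction σ₁‖ / (σ₁ - β₁) := by gcongr
    have h1β : 0 ≤ 1 - β₁ := by linarith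
    have hL1 : ‖χ.LFunction 1‖ = (1 - β₁) * ‖g 1‖ := by
      have h := PagePNT.LFunction_eq_mul_dslope χ hLβ₁ 1
      rw [h, norm_mul]
      congr 1
      rw [show (1 : ℂ) - (β₁ : ℂ) = ((1 - β₁ : ℝ) : ℂ) by push_cast; ring, Complex.norm_real,
        Real.norm_of_nonneg h1β]
    rw [hL1]
    have hg1 : Real.exp (-(C / 8)) / (9 * (1 / 8 + 2 * c)) ≤ ‖g 1‖ := by
      have h1 : ‖g σ₁‖ * Real.exp (-(C / 8)) ≤ ‖g 1‖ := by
        rw [Real.exp_neg, ← div_eq_mul_inv, div_le_iff₀ (Real.exp_pos _)]; exact hfwd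
      calc Real.exp (-(C / 8)) / (9 * (1 / 8 + 2 * c))
          = 1 / (9 * (1 / 8 + 2 * c)) * Real.exp (-(C / 8)) := by ring
        _ ≤ ‖g σ₁‖ * Real.exp (-(C / 8)) := by gcongr
        _ ≤ ‖g 1‖ := h1
    calc Real.exp (-(C / 8)) / (9 * (1 / 8 + 2 * c)) * (1 - β₁) ≤ ‖g 1‖ * (1 - β₁) := by gcongr
      _ = (1 - β₁) * ‖g 1‖ := mul_comm _ _

/-- `Z22:(1.1)` DISCHARGED: "the non-existence of the Landau–Siegel zero implies
`L(1,χ) ≫ (log D)⁻¹`" in the reading `NoSiegelZeros → LOneLowerBound 1` (the tree's rh.S34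
conjecture as antecedent, the manuscript's (1.1) as conclusion): by `hecke_lOne_lower_bounds`, a
real zero `β > 1 − 2c/log 4D` has `1 − β ≥ c′/log D` under `NoSiegelZeros` (constant `c′`), whence
`‖L(1,χ)‖ ≥ C₁c′/log D`; otherwise `‖L(1,χ)‖ ≥ C₀/log 4D ≥ C₀/(3 log D)`.
[cite: Zhang2022LandauSiegel, §1 (1.1) p.2] [cite: MontgomeryVaughan2007, Thm. 11.4] -/
theorem eq11Imp_holds : Eq11Imp := by
  intro hNS
  obtain ⟨c', hc', hno⟩ := hNS
  obtain ⟨c, hc, C₀, hC₀, C₁, hC₁, H⟩ := hecke_lOne_lower_bounds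
  refine ⟨min (C₀ / 6) (C₁ * c' / 2), lt_min (by positivity) (by positivity),
    fun D _ χ hD hq hp => ?_⟩
  have hχ : χ ≠ 1 := Skeleton.ne_one_of_isPrimitive_of_three_le hp hD
  obtain ⟨hnoexc, hexc⟩ := H D χ hχ
  have hlog1 : 1 ≤ Real.log D := one_le_log_of_three_le hD
  have hlog0 : 0 < Real.log D := by linarith
  have hℒ : Real.log D + Real.log 4 ≤ 3 * Real.log D := ell0_le_three_mul_log hD
  have hℒpos : 0 < Real.log D + Real.log 4 := by
    have := Real.log_pos (by norm_num : (1 : ℝ) < 4); linarith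
  rw [pow_one]
  by_cases hex : ∃ β : ℝ, χ.LFunction β = 0 ∧ 1 - 2 * c / (Real.log D + Real.log 4) < β
  · obtain ⟨β, hβ0, hβ⟩ := hex
    have hβle : β ≤ 1 - c' / Real.log D := by
      by_contra hlt
      push Not at hlt
      exact hno D hD χ hq hp β hlt hβ0
    have h1 := hexc β hβ0 hβ
    have h2 : C₁ * c' / Real.log D ≤ ‖χ.LFunction 1‖ :=
      calc C₁ * c' / Real.log D = C₁ * (c' / Real.log D) := by ring
        _ ≤ C₁ * (1 - β) := by gcongr; linarith
        _ ≤ ‖χ.LFunction 1‖ := h1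
    calc min (C₀ / 6) (C₁ * c' / 2) / Real.log D ≤ (C₁ * c' / 2) / Real.log D := by
          gcongr; exact min_le_right _ _
      _ < C₁ * c' / Real.log D := by
          apply div_lt_div_of_pos_right _ hlog0
          have : 0 < C₁ * c' := by positivity
          linarith
      _ ≤ ‖χ.LFunction 1‖ := h2
  · push Not at hex
    have hnone : ∀ β : ℝ, χ.LFunction β = 0 → β ≤ 1 - 2 * c / (Real.log D + Real.log 4) :=
      fun β hβ => hex β hβ
    have h0 := hnoexc hnone
    have h2 : C₀ / (3 * Real.log D) ≤ ‖χ.LFunction 1‖ :=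
      le_trans (div_le_div_of_nonneg_left hC₀.le hℒpos hℒ) h0
    calc min (C₀ / 6) (C₁ * c' / 2) / Real.log D ≤ (C₀ / 6) / Real.log D := by
          gcongr; exact min_le_left _ _
      _ < C₀ / (3 * Real.log D) := by
          rw [div_div]
          exact div_lt_div_of_pos_left hC₀ (by positivity) (by linarith)
      _ ≤ ‖χ.LFunction 1‖ := h2

/-- `Eq11Imp` — `_holds` alias of `eq11Imp_holds` above under the fact's exact name (appended
2026-08-28, D-0026 bookkeeping: the proof term is the existing theorem of this file; no statement,
definition or attribute is edited; no new named fact; the ledger's debt table listed the fact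
unproved). [cite: MontgomeryVaughan2007, Thm. 11.4] -/
theorem _root_.Literature.NumberTheory.LFunctions.Zhang2022.Section1.Eq11Imp_holds : Eq11Imp :=
  _root_.Literature.NumberTheory.LFunctions.Zhang2022.Section1.eq11Imp_holds

/-- A lower bound `L(1,χ) > c₁(log D)^{−A}` for all real primitive `χ` implies the same with any
larger exponent (`log D ≥ 1` for `D ≥ 3`). [cite: Zhang2022LandauSiegel, §1 p.3] -/
theorem lOneLowerBound_mono {A B : ℕ} (hAB : A ≤ B) (h : Skeleton.LOneLowerBound A) :
    Skeleton.LOneLowerBound B := by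
  obtain ⟨c₁, hc₁, h⟩ := h
  refine ⟨c₁, hc₁, fun D _ χ hD hq hp => lt_of_le_of_lt ?_ (h D χ hD hq hp)⟩
  have hlog : 1 ≤ Real.log D := one_le_log_of_three_le hD
  exact div_le_div_of_nonneg_left hc₁.le (pow_pos (by linarith) _) (pow_le_pow_right₀ hlog hAB)

/-- **Context for the adjudication: the manuscript's Theorem 1 is a CONSEQUENCE of the tree's
conjecture `NoSiegelZeros` (rh.S34)** — `(log D)⁻¹ ≥ (log D)⁻²⁰²²`. Kernel-checked implication;
it asserts neither side. [cite: Zhang2022LandauSiegel, §1 Theorem 1 p.3] -/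
theorem theorem1_of_noSiegelZeros (h : NoSiegelZeros) : Skeleton.Theorem1 :=
  lOneLowerBound_mono (by norm_num) (eq11Imp_holds h)

/-- … and hence so is Theorem 2 (`Skeleton.theorem2_of_theorem1`).
[cite: Zhang2022LandauSiegel, §1 Theorem 2 p.3] -/
theorem theorem2_of_noSiegelZeros (h : NoSiegelZeros) : Skeleton.Theorem2 :=
  Skeleton.theorem2_of_theorem1 (theorem1_of_noSiegelZeros h)

end Literature.NumberTheory.LFunctions.Zhang2022.Section1

namespace Literature.NumberTheory.LFunctions.Zhang2022.Section1

open Literature.NumberTheory.LFunctions.Zhang2022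
open Literature.NumberTheory.LFunctions

/-- `Z22:§1.u003` DISCHARGED: "`L(σ,χ) ≠ 0` if `σ > 1 − C₂(ε)D^{−ε}`", from Siegel's theorem at
`ε/2` (`step1u002`) and Montgomery–Vaughan (11.10) (`MontgomeryVaughan2007_thm11_4_LOne_exceptional_holds`):
a real zero `σ < 1` that close to `1` is either outside the exceptional region — impossible once
`C₂ ≤ cₑε/3`, since `cₑ/log 4D ≥ (cₑε/3)D^{−ε}` (`log x ≤ x^ε/ε`) — or exceptional, and then
`L(1,χ) ≤ C(1 − σ)log²D < C·C₂D^{−ε}·16ε⁻²D^{ε/2} ≤ S·D^{−ε/2}` contradicts Siegel.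
`C₂ = min(cₑε/3, Sε²/(16C))`. [cite: Zhang2022LandauSiegel, §1 p.2]
[cite: MontgomeryVaughan2007, Thm. 11.4 (11.10)] -/
theorem step1u003_holds : Step1u003 := by
  intro ε hε
  obtain ⟨S, hS, hSie⟩ := step1u002 (ε / 2) (by positivity)
  obtain ⟨cₑ, hcₑ, C₁, C₂', hC₁, hC₂', hE⟩ := MontgomeryVaughan2007_thm11_4_LOne_exceptional_holds
  refine ⟨min (cₑ * ε / 3) (S * ε ^ 2 / (16 * C₂')), lt_min (by positivity) (by positivity),
    fun D _ χ hD hq hp σ hσ hzero => ?_⟩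
  have hχ : χ ≠ 1 := Skeleton.ne_one_of_isPrimitive_of_three_le hp hD
  have hD3 : (3 : ℝ) ≤ D := by exact_mod_cast hD
  have hD0 : (0 : ℝ) < D := by linarith
  have hlog1 : 1 ≤ Real.log D := one_le_log_of_three_le hD
  have hlog0 : 0 < Real.log D := by linarith
  have hεne : ε ≠ 0 := hε.ne'
  have hC₂'ne : C₂' ≠ 0 := hC₂'.ne'
  have hC₂a : min (cₑ * ε / 3) (S * ε ^ 2 / (16 * C₂')) ≤ cₑ * ε / 3 := min_le_left _ _
  have hC₂b : min (cₑ * ε / 3) (S * ε ^ 2 / (16 * C₂')) ≤ S * ε ^ 2 / (16 * C₂') :=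
    min_le_right _ _
  -- the zero is `< 1`
  have hσ1 : σ < 1 := by
    by_contra hge
    push Not at hge
    exact χ.LFunction_ne_zero_of_one_le_re (Or.inl hχ) (by simpa using hge) hzero
  have hpow_pos : ∀ a : ℝ, 0 < (D : ℝ) ^ a := fun a => Real.rpow_pos_of_pos hD0 a
  have hDε : 0 < (D : ℝ) ^ ε := hpow_pos ε
  have hDεne : (D : ℝ) ^ ε ≠ 0 := hDε.ne'
  have hlogle : Real.log D ≤ (D : ℝ) ^ ε / ε := Real.log_le_rpow_div hD0.le hε
  have hlogle4 : Real.log D ≤ (D : ℝ) ^ (ε / 4) / (ε / 4) :=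
    Real.log_le_rpow_div hD0.le (by positivity)
  have h1σ : 1 - σ < min (cₑ * ε / 3) (S * ε ^ 2 / (16 * C₂')) * (D : ℝ) ^ (-ε) := by linarith
  have hneg : (D : ℝ) ^ (-ε) = ((D : ℝ) ^ ε)⁻¹ := Real.rpow_neg hD0.le ε
  by_cases hcase : 1 - cₑ / Real.log (4 * D) < σ
  · -- exceptional zero: (11.10) upper bound against Siegel at `ε/2`
    obtain ⟨-, hup⟩ := hE D χ hχ hq σ hcase hσ1 hzero
    have hlow := hSie D χ hD hq hp
    have hlogsq : Real.log D ^ 2 ≤ 16 * (D : ℝ) ^ (ε / 2) / ε ^ 2 := by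
      have h4 : Real.log D ≤ 4 * (D : ℝ) ^ (ε / 4) / ε := by
        calc Real.log D ≤ (D : ℝ) ^ (ε / 4) / (ε / 4) := hlogle4
          _ = 4 * (D : ℝ) ^ (ε / 4) / ε := by field_simp
      have hsq : ((D : ℝ) ^ (ε / 4)) ^ 2 = (D : ℝ) ^ (ε / 2) := by
        rw [← Real.rpow_natCast, ← Real.rpow_mul hD0.le]
        congr 1
        push_cast
        ring
      calc Real.log D ^ 2 ≤ (4 * (D : ℝ) ^ (ε / 4) / ε) ^ 2 := pow_le_pow_left₀ hlog0.le h4 2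
        _ = 16 * ((D : ℝ) ^ (ε / 4)) ^ 2 / ε ^ 2 := by ring
        _ = 16 * (D : ℝ) ^ (ε / 2) / ε ^ 2 := by rw [hsq]
    have hDhalf : (D : ℝ) ^ (-(ε / 2)) = (D : ℝ) ^ (-ε) * (D : ℝ) ^ (ε / 2) := by
      rw [← Real.rpow_add hD0]
      congr 1
      ring
    have hl2 : 0 < Real.log D ^ 2 := by positivity
    have hstep : C₂' * (1 - σ) * Real.log D ^ 2
        < C₂' * (min (cₑ * ε / 3) (S * ε ^ 2 / (16 * C₂')) * (D : ℝ) ^ (-ε)) * Real.log D ^ 2 := by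
      have := mul_lt_mul_of_pos_left h1σ (mul_pos hC₂' hl2)
      linarith
    have hchain : ‖χ.LFunction 1‖ < S * (D : ℝ) ^ (-(ε / 2)) :=
      calc ‖χ.LFunction 1‖ ≤ C₂' * (1 - σ) * Real.log D ^ 2 := hup
        _ < C₂' * (min (cₑ * ε / 3) (S * ε ^ 2 / (16 * C₂')) * (D : ℝ) ^ (-ε))
              * Real.log D ^ 2 := hstep
        _ ≤ C₂' * (S * ε ^ 2 / (16 * C₂') * (D : ℝ) ^ (-ε)) * (16 * (D : ℝ) ^ (ε / 2) / ε ^ 2) := by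
            apply mul_le_mul _ hlogsq hl2.le (by positivity)
            exact mul_le_mul_of_nonneg_left
              (mul_le_mul_of_nonneg_right hC₂b (hpow_pos _).le) hC₂'.le
        _ = S * ((D : ℝ) ^ (-ε) * (D : ℝ) ^ (ε / 2)) := by field_simp
        _ = S * (D : ℝ) ^ (-(ε / 2)) := by rw [hDhalf]
    linarith
  · -- a zero outside the exceptional region is too far from `1`
    push Not at hcase
    have hlog4D : Real.log (4 * D) ≤ 3 * Real.log D := log_four_mul_le_three_mul_log (by linarith)
    have hlog4Dpos : 0 < Real.log (4 * D) := Real.log_pos (by linarith)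
    have hfar : cₑ * ε / 3 * (D : ℝ) ^ (-ε) ≤ cₑ / Real.log (4 * D) := by
      rw [hneg]
      have h3 : Real.log (4 * D) ≤ 3 * ((D : ℝ) ^ ε / ε) := hlog4D.trans (by linarith [hlogle])
      rw [show cₑ * ε / 3 * ((D : ℝ) ^ ε)⁻¹ = cₑ / (3 * ((D : ℝ) ^ ε / ε)) by field_simp]
      exact div_le_div_of_nonneg_left hcₑ.le hlog4Dpos h3
    have : 1 - σ < cₑ * ε / 3 * (D : ℝ) ^ (-ε) :=
      lt_of_lt_of_le h1σ (mul_le_mul_of_nonneg_right hC₂a (hpow_pos _).le)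
    linarith

/-- `Step1u003` — `_holds` alias of `step1u003_holds` above under the fact's exact name (appended
2026-08-28, D-0026 bookkeeping: the proof term is the existing theorem of this file; no statement,
definition or attribute is edited; no new named fact; the ledger's debt table listed the fact
unproved). [cite: MontgomeryVaughan2007, Thm. 11.4 (11.10)] -/
theorem _root_.Literature.NumberTheory.LFunctions.Zhang2022.Section1.Step1u003_holds : Step1u003 :=
  _root_.Literature.NumberTheory.LFunctions.Zhang2022.Section1.step1u003_holds

end Literature.NumberTheory.LFunctions.Zhang2022.Section1

namespace Literature.NumberTheory.LFunctions.Zhang2022.Section2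

/-- `Eq22` — `_holds` alias of `eq22_holds` under the fact's exact name (D-0026 bookkeeping: the proof
term is the existing theorem of this file; no statement is edited). [cite: Zhang2022LandauSiegel, §2 (2.2) p.4] -/
theorem Eq22_holds : Eq22 := eq22_holds

/-- `Eq24` — `_holds` alias of `eq24_holds` under the fact's exact name (D-0026 bookkeeping).
[cite: Zhang2022LandauSiegel, §2 (2.4) p.5] -/
theorem Eq24_holds : Eq24 := eq24_holds

/-- `Eq25` — `_holds` alias of `eq25_holds` under the fact's exact name (D-0026 bookkeeping).
[cite: Zhang2022LandauSiegel, §2 (2.5) p.5] -/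
theorem Eq25_holds : Eq25 := eq25_holds

end Literature.NumberTheory.LFunctions.Zhang2022.Section2
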